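import Mathlib
import Summits.Ventures.PercRepro2.Defs
import Summits.Ventures.PercRepro2.Independence
import Summits.Ventures.PercRepro2.Harris
import Summits.Ventures.PercRepro2.Graph
import Summits.Ventures.PercRepro2.Exploration
import Summits.Ventures.PercRepro2.Events
import Summits.Ventures.PercRepro2.FourFunctions
import Summits.Ventures.PercRepro2.Induced
import Summits.Ventures.PercRepro2.Frontier
import Summits.Ventures.PercRepro2.ObsIndependence
import Summits.Ventures.PercRepro2.BHK
import Summits.Ventures.PercRepro2.BHKEvents
import Summits.Ventures.PercRepro2.OrderPreservation
import Summits.Ventures.PercRepro2.OrderPreservationDual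
import Summits.Ventures.PercRepro2.VdBKahn
import Summits.Ventures.PercRepro2.BHKAvoid
import Summits.Ventures.PercRepro2.R2PrimeThreeReduction
import Summits.Ventures.PercRepro2.YBridge
import Summits.Ventures.PercRepro2.Yu1Functionals
import Summits.Ventures.PercRepro2.Yu1Events

import Summits.Ventures.PercRepro2.Yu1

import Summits.Ventures.PercRepro2.LBSplit

/-!
# The Δ-absorbed pieces of (Y): Lean names for the census rows (blind cell PercRepro2, typer-1;
`proofs/LEAD-PROOFSHAPES.md` §8.9 ADDENDA 12–13, CONJECTURES rows 2′Y1Δ / 2′Y2Δ)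

Vocabulary of `YBridge` (`a₁ = a_l`, `a₂ = a_h`, `a₃` the third root, `o`, `b`): `PD`, `T = {a₁ ∉ C₂,
a₃ ∈ C₂}`, `T′ = TEvent a₂ a₁ a₃ = {a₂ ∉ C₁, a₃ ∈ C₁}`, `W = M₂ + Δ_T`, `R = avoidAll a₁ {a₂, a₃}`,
`R_h = avoidAll a₂ {a₁, a₃}`.

* `deltaL = Δ_l = P(T, o ∈ C₁, b ∈ C₁) − P(T, o ∈ C₁, b ∈ C₂)`, `deltaH = Δ_h` (mirror, `T′`);
  bookkeeping `Tlh_sub_deltaL`: `T_{l→h} − Δ_l = P(o ∈ C₁, b ∈ C₂, R) − P(o ∈ C₁, b ∈ C₁, T)`.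
* `Yu1Delta`: `(Yu1Δ)` `T_{l→h} · P(PD) ≤ P(PD, o ∈ C₁) · W + Δ_l · P(PD)`; `Yu2Delta` its mirror;
  `LA` / `LAh`: the strong b-split forms `(T_{l→h} − Δ_l) · P(PD, b ∉ C₁) ≤ P(PD, o ∈ C₁, b ∉ C₁) · W`;
  `LB` / `LBh`: the weak forms (`b ∈ C₁`); all hypothesis-free (no labelling) as census rows, with the
  `_all` closures quantifying over every finite graph (`Yu1Delta_all`, `Yu2Delta_all`, `LA_all`, `LAh_all`).
* `LB_of_order`: `LB` under the labelling `P(b ↔ a₁) ≤ P(b ↔ a₂)` — this is `lb_light` (ADDENDUM 13 (2)).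
-/

namespace Summit.Ventures.PercRepro2

open UnionCluster

section YDeltaDefs

variable {V : Type*} {E : Type*} [Fintype E] [DecidableEq E] [Fintype V] [DecidableEq V]
  {R : Type*} [Field R] [LinearOrder R] [IsStrictOrderedRing R]

/-- `Δ_l = P(C₁ ≠ C₂, o ∈ C₁, a₃ ∈ C₂, b ∈ C₁) − P(C₁ ≠ C₂, o ∈ C₁, a₃ ∈ C₂, b ∈ C₂)`. -/
noncomputable def deltaL (p : E → R) (ends : E → Sym2 V) (o a₁ a₂ a₃ b : V) : R :=
  prob p (TEvent ends a₁ a₂ a₃ ∩ connEvent ends a₁ o ∩ connEvent ends a₁ b) -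
    prob p (TEvent ends a₁ a₂ a₃ ∩ connEvent ends a₁ o ∩ connEvent ends a₂ b)

/-- `Δ_h = P(C₁ ≠ C₂, o ∈ C₂, a₃ ∈ C₁, b ∈ C₂) − P(C₁ ≠ C₂, o ∈ C₂, a₃ ∈ C₁, b ∈ C₁)` (the mirror of
`Δ_l`; `TEvent a₂ a₁ a₃ = {a₂ ∉ C₁, a₃ ∈ C₁}`). -/
noncomputable def deltaH (p : E → R) (ends : E → Sym2 V) (o a₁ a₂ a₃ b : V) : R :=
  prob p (TEvent ends a₂ a₁ a₃ ∩ connEvent ends a₂ o ∩ connEvent ends a₂ b) -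
    prob p (TEvent ends a₂ a₁ a₃ ∩ connEvent ends a₂ o ∩ connEvent ends a₁ b)

/-- **(Yu1Δ)** (row 2′Y1Δ, cleared by `P(PD)`): `T_{l→h} · P(PD) ≤ P(PD, o ∈ C₁) · W + Δ_l · P(PD)`,
i.e. `g_l · W − T_{l→h} + Δ_l ≥ 0`. -/
def Yu1Delta (p : E → R) (ends : E → Sym2 V) (o a₁ a₂ a₃ b : V) : Prop :=
  prob p (PDEvent ends a₁ a₂ a₃ ∩ connEvent ends a₁ o ∩ connEvent ends a₂ b) *
      prob p (PDEvent ends a₁ a₂ a₃) ≤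
    prob p (PDEvent ends a₁ a₂ a₃ ∩ connEvent ends a₁ o) *
        (massM2 p ends a₁ a₂ a₃ b + deltaT p ends a₁ a₂ a₃ b) +
      deltaL p ends o a₁ a₂ a₃ b * prob p (PDEvent ends a₁ a₂ a₃)

/-- **(Yu2Δ)** (row 2′Y2Δ, cleared by `P(PD)`): `T_{h→l} · P(PD) ≤ P(PD, o ∈ C₂) · W + Δ_h · P(PD)`. -/
def Yu2Delta (p : E → R) (ends : E → Sym2 V) (o a₁ a₂ a₃ b : V) : Prop :=
  prob p (PDEvent ends a₁ a₂ a₃ ∩ connEvent ends a₂ o ∩ connEvent ends a₁ b) *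
      prob p (PDEvent ends a₁ a₂ a₃) ≤
    prob p (PDEvent ends a₁ a₂ a₃ ∩ connEvent ends a₂ o) *
        (massM2 p ends a₁ a₂ a₃ b + deltaT p ends a₁ a₂ a₃ b) +
      deltaH p ends o a₁ a₂ a₃ b * prob p (PDEvent ends a₁ a₂ a₃)

/-- **(L_A)** (ADDENDUM 13 (1), strong b-split form):
`(T_{l→h} − Δ_l) · P(PD, b ∉ C₁) ≤ P(PD, o ∈ C₁, b ∉ C₁) · W`. -/
def LA (p : E → R) (ends : E → Sym2 V) (o a₁ a₂ a₃ b : V) : Prop :=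
  (prob p (PDEvent ends a₁ a₂ a₃ ∩ connEvent ends a₁ o ∩ connEvent ends a₂ b) -
      deltaL p ends o a₁ a₂ a₃ b) *
      prob p (PDEvent ends a₁ a₂ a₃ ∩ (connEvent ends a₁ b)ᶜ) ≤
    prob p (PDEvent ends a₁ a₂ a₃ ∩ connEvent ends a₁ o ∩ (connEvent ends a₁ b)ᶜ) *
      (massM2 p ends a₁ a₂ a₃ b + deltaT p ends a₁ a₂ a₃ b)

/-- **(L_B)** (ADDENDUM 13 (1), weak b-split form):
`(T_{l→h} − Δ_l) · P(PD, b ∈ C₁) ≤ P(PD, o ∈ C₁, b ∈ C₁) · W`. -/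
def LB (p : E → R) (ends : E → Sym2 V) (o a₁ a₂ a₃ b : V) : Prop :=
  (prob p (PDEvent ends a₁ a₂ a₃ ∩ connEvent ends a₁ o ∩ connEvent ends a₂ b) -
      deltaL p ends o a₁ a₂ a₃ b) *
      prob p (PDEvent ends a₁ a₂ a₃ ∩ connEvent ends a₁ b) ≤
    prob p (PDEvent ends a₁ a₂ a₃ ∩ connEvent ends a₁ o ∩ connEvent ends a₁ b) *
      (massM2 p ends a₁ a₂ a₃ b + deltaT p ends a₁ a₂ a₃ b)

/-- **(L_A^h)** (ADDENDUM 13 (4)): `(T_{h→l} − Δ_h) · P(PD, b ∉ C₂) ≤ P(PD, o ∈ C₂, b ∉ C₂) · W`. -/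
def LAh (p : E → R) (ends : E → Sym2 V) (o a₁ a₂ a₃ b : V) : Prop :=
  (prob p (PDEvent ends a₁ a₂ a₃ ∩ connEvent ends a₂ o ∩ connEvent ends a₁ b) -
      deltaH p ends o a₁ a₂ a₃ b) *
      prob p (PDEvent ends a₁ a₂ a₃ ∩ (connEvent ends a₂ b)ᶜ) ≤
    prob p (PDEvent ends a₁ a₂ a₃ ∩ connEvent ends a₂ o ∩ (connEvent ends a₂ b)ᶜ) *
      (massM2 p ends a₁ a₂ a₃ b + deltaT p ends a₁ a₂ a₃ b)

/-- **(L_B^h)** (ADDENDUM 13 (4)): `(T_{h→l} − Δ_h) · P(PD, b ∈ C₂) ≤ P(PD, o ∈ C₂, b ∈ C₂) · W`. -/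
def LBh (p : E → R) (ends : E → Sym2 V) (o a₁ a₂ a₃ b : V) : Prop :=
  (prob p (PDEvent ends a₁ a₂ a₃ ∩ connEvent ends a₂ o ∩ connEvent ends a₁ b) -
      deltaH p ends o a₁ a₂ a₃ b) *
      prob p (PDEvent ends a₁ a₂ a₃ ∩ connEvent ends a₂ b) ≤
    prob p (PDEvent ends a₁ a₂ a₃ ∩ connEvent ends a₂ o ∩ connEvent ends a₂ b) *
      (massM2 p ends a₁ a₂ a₃ b + deltaT p ends a₁ a₂ a₃ b)

end YDeltaDefs

section YDeltaClosures

variable (R : Type*) [Field R] [LinearOrder R] [IsStrictOrderedRing R]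

/-- **(Yu1Δ) for every finite graph**, hypothesis-free (no labelling; `a₃` arbitrary). -/
def Yu1Delta_all : Prop :=
  ∀ (V E : Type) [Fintype V] [DecidableEq V] [Fintype E] [DecidableEq E]
    (ends : E → Sym2 V) (p : E → R), IsProbVec p →
    ∀ o a₁ a₂ a₃ b : V, a₁ ≠ a₂ → a₁ ≠ a₃ → a₂ ≠ a₃ → o ≠ a₁ → o ≠ a₂ → o ≠ a₃ → o ≠ b →
      b ≠ a₁ → b ≠ a₂ → b ≠ a₃ → Yu1Delta p ends o a₁ a₂ a₃ b

/-- **(Yu2Δ) for every finite graph**, hypothesis-free. -/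
def Yu2Delta_all : Prop :=
  ∀ (V E : Type) [Fintype V] [DecidableEq V] [Fintype E] [DecidableEq E]
    (ends : E → Sym2 V) (p : E → R), IsProbVec p →
    ∀ o a₁ a₂ a₃ b : V, a₁ ≠ a₂ → a₁ ≠ a₃ → a₂ ≠ a₃ → o ≠ a₁ → o ≠ a₂ → o ≠ a₃ → o ≠ b →
      b ≠ a₁ → b ≠ a₂ → b ≠ a₃ → Yu2Delta p ends o a₁ a₂ a₃ b

/-- **(L_A) for every finite graph**, hypothesis-free. -/
def LA_all : Prop :=
  ∀ (V E : Type) [Fintype V] [DecidableEq V] [Fintype E] [DecidableEq E]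
    (ends : E → Sym2 V) (p : E → R), IsProbVec p →
    ∀ o a₁ a₂ a₃ b : V, a₁ ≠ a₂ → a₁ ≠ a₃ → a₂ ≠ a₃ → o ≠ a₁ → o ≠ a₂ → o ≠ a₃ → o ≠ b →
      b ≠ a₁ → b ≠ a₂ → b ≠ a₃ → LA p ends o a₁ a₂ a₃ b

/-- **(L_A^h) for every finite graph**, hypothesis-free. -/
def LAh_all : Prop :=
  ∀ (V E : Type) [Fintype V] [DecidableEq V] [Fintype E] [DecidableEq E]
    (ends : E → Sym2 V) (p : E → R), IsProbVec p →
    ∀ o a₁ a₂ a₃ b : V, a₁ ≠ a₂ → a₁ ≠ a₃ → a₂ ≠ a₃ → o ≠ a₁ → o ≠ a₂ → o ≠ a₃ → o ≠ b →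
      b ≠ a₁ → b ≠ a₂ → b ≠ a₃ → LAh p ends o a₁ a₂ a₃ b

end YDeltaClosures

section YDeltaFacts

variable {V : Type*} {E : Type*} [Fintype E] [DecidableEq E] [Fintype V] [DecidableEq V]
  {R : Type*} [Field R] [LinearOrder R] [IsStrictOrderedRing R]

omit [Fintype V] [LinearOrder R] [IsStrictOrderedRing R] in
/-- `P(PD, o ∈ C₁, b ∈ C₂) + P(T, o ∈ C₁, b ∈ C₂) = P(o ∈ C₁, b ∈ C₂, R)`: split `R` along `a₃ ∈ C₂`. -/
lemma prob_PD_add_T_ob (p : E → R) (ends : E → Sym2 V) (o a₁ a₂ a₃ b : V) :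
    prob p (PDEvent ends a₁ a₂ a₃ ∩ connEvent ends a₁ o ∩ connEvent ends a₂ b) +
        prob p (TEvent ends a₁ a₂ a₃ ∩ connEvent ends a₁ o ∩ connEvent ends a₂ b) =
      prob p (connEvent ends a₁ o ∩ connEvent ends a₂ b ∩ avoidAll ends a₁ {a₂, a₃}) := by
  have h := prob_inter_add_prob_inter_compl p
    (connEvent ends a₁ o ∩ connEvent ends a₂ b ∩ avoidAll ends a₁ {a₂, a₃}) (connEvent ends a₂ a₃)
  have e1 : connEvent ends a₁ o ∩ connEvent ends a₂ b ∩ avoidAll ends a₁ {a₂, a₃} ∩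
      connEvent ends a₂ a₃ = TEvent ends a₁ a₂ a₃ ∩ connEvent ends a₁ o ∩ connEvent ends a₂ b := by
    ext ω
    simp only [Set.mem_inter_iff, mem_connEvent, avoidAll, Finset.mem_insert, Finset.mem_singleton,
      TEvent, Set.mem_setOf_eq, Set.mem_compl_iff]
    constructor
    · rintro ⟨⟨⟨ho, hb⟩, hR⟩, h23⟩
      exact ⟨⟨⟨fun h' => hR _ (Or.inl rfl) (conn_symm h'), h23⟩, ho⟩, hb⟩
    · rintro ⟨⟨⟨h21, h23⟩, ho⟩, hb⟩
      refine ⟨⟨⟨ho, hb⟩, ?_⟩, h23⟩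
      intro x hx
      rcases hx with rfl | rfl
      · exact fun h' => h21 (conn_symm h')
      · exact fun h' => h21 (conn_trans h23 (conn_symm h'))
  have e2 : connEvent ends a₁ o ∩ connEvent ends a₂ b ∩ avoidAll ends a₁ {a₂, a₃} ∩
      (connEvent ends a₂ a₃)ᶜ = PDEvent ends a₁ a₂ a₃ ∩ connEvent ends a₁ o ∩ connEvent ends a₂ b := by
    ext ω
    simp only [Set.mem_inter_iff, mem_connEvent, avoidAll, Finset.mem_insert, Finset.mem_singleton,
      PDEvent, Dtilde, inU, Set.mem_compl_iff, Set.mem_union]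
    constructor
    · rintro ⟨⟨⟨ho, hb⟩, hR⟩, h23⟩
      exact ⟨⟨⟨hR _ (Or.inl rfl), fun h' => h'.elim (fun h' => hR _ (Or.inr rfl) (conn_symm h'))
        (fun h' => h23 (conn_symm h'))⟩, ho⟩, hb⟩
    · rintro ⟨⟨⟨h12, h3⟩, ho⟩, hb⟩
      refine ⟨⟨⟨ho, hb⟩, ?_⟩, fun h' => h3 (Or.inr (conn_symm h'))⟩
      intro x hx
      rcases hx with rfl | rfl
      · exact h12
      · exact fun h' => h3 (Or.inl (conn_symm h'))
  rw [e1, e2] at h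
  rw [add_comm]
  exact h

omit [Fintype V] [LinearOrder R] [IsStrictOrderedRing R] in
/-- Bookkeeping: `T_{l→h} − Δ_l = P(o ∈ C₁, b ∈ C₂, R) − P(o ∈ C₁, b ∈ C₁, T)`. -/
lemma Tlh_sub_deltaL (p : E → R) (ends : E → Sym2 V) (o a₁ a₂ a₃ b : V) :
    prob p (PDEvent ends a₁ a₂ a₃ ∩ connEvent ends a₁ o ∩ connEvent ends a₂ b) -
        deltaL p ends o a₁ a₂ a₃ b =
      prob p (connEvent ends a₁ o ∩ connEvent ends a₂ b ∩ avoidAll ends a₁ {a₂, a₃}) -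
        prob p (connEvent ends a₁ o ∩ connEvent ends a₁ b ∩ TEvent ends a₁ a₂ a₃) := by
  have h := prob_PD_add_T_ob p ends o a₁ a₂ a₃ b
  have e : TEvent ends a₁ a₂ a₃ ∩ connEvent ends a₁ o ∩ connEvent ends a₁ b =
      connEvent ends a₁ o ∩ connEvent ends a₁ b ∩ TEvent ends a₁ a₂ a₃ := by
    ext ω
    simp only [Set.mem_inter_iff]
    tauto
  unfold deltaL
  rw [e, ← h]
  ring

/-- **`LB` holds** under the labelling `P(b ↔ a₁) ≤ P(b ↔ a₂)` (`lb_light`, ADDENDUM 13 (2)). -/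
theorem LB_of_order (p : E → R) (hp : IsProbVec p) (ends : E → Sym2 V) {o a₁ a₂ a₃ b : V}
    (hord : prob p (connEvent ends a₁ b) ≤ prob p (connEvent ends a₂ b)) :
    LB p ends o a₁ a₂ a₃ b := by
  unfold LB
  rw [Tlh_sub_deltaL]
  exact lb_light p hp ends hord

omit [Fintype V] [DecidableEq V] [LinearOrder R] [IsStrictOrderedRing R] in
/-- `P(PD) = P(PD, b ∈ C₁) + P(PD, b ∉ C₁)`. -/
lemma prob_PD_split_b (p : E → R) (ends : E → Sym2 V) (a₁ a₂ a₃ b : V) :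
    prob p (PDEvent ends a₁ a₂ a₃) =
      prob p (PDEvent ends a₁ a₂ a₃ ∩ connEvent ends a₁ b) +
        prob p (PDEvent ends a₁ a₂ a₃ ∩ (connEvent ends a₁ b)ᶜ) :=
  (prob_inter_add_prob_inter_compl p _ _).symm

omit [Fintype V] [DecidableEq V] [LinearOrder R] [IsStrictOrderedRing R] in
/-- `P(PD, o ∈ C₁) = P(PD, o ∈ C₁, b ∈ C₁) + P(PD, o ∈ C₁, b ∉ C₁)`. -/
lemma prob_PDo_split_b (p : E → R) (ends : E → Sym2 V) (o a₁ a₂ a₃ b : V) :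
    prob p (PDEvent ends a₁ a₂ a₃ ∩ connEvent ends a₁ o) =
      prob p (PDEvent ends a₁ a₂ a₃ ∩ connEvent ends a₁ o ∩ connEvent ends a₁ b) +
        prob p (PDEvent ends a₁ a₂ a₃ ∩ connEvent ends a₁ o ∩ (connEvent ends a₁ b)ᶜ) :=
  (prob_inter_add_prob_inter_compl p _ _).symm

omit [Fintype V] [DecidableEq V] [LinearOrder R] [IsStrictOrderedRing R] in
/-- **The b-split ring identity** (ADDENDUM 13 (1), 14): the (Yu1Δ)-slack, cleared by `P(PD)`, is the
sum of the (L_A)-slack and the (L_B)-slack: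
`P(PD, o ∈ C₁) W + Δ_l P(PD) − T_{l→h} P(PD) = [C W − (T_{l→h} − Δ_l) D] + [C′ W − (T_{l→h} − Δ_l) D′]`
with `C, D` the `b ∉ C₁` masses and `C′, D′` the `b ∈ C₁` masses. -/
theorem Yu1Delta_slack_eq (p : E → R) (ends : E → Sym2 V) (o a₁ a₂ a₃ b : V) :
    prob p (PDEvent ends a₁ a₂ a₃ ∩ connEvent ends a₁ o) *
          (massM2 p ends a₁ a₂ a₃ b + deltaT p ends a₁ a₂ a₃ b) +
        deltaL p ends o a₁ a₂ a₃ b * prob p (PDEvent ends a₁ a₂ a₃) -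
      prob p (PDEvent ends a₁ a₂ a₃ ∩ connEvent ends a₁ o ∩ connEvent ends a₂ b) *
        prob p (PDEvent ends a₁ a₂ a₃) =
    (prob p (PDEvent ends a₁ a₂ a₃ ∩ connEvent ends a₁ o ∩ (connEvent ends a₁ b)ᶜ) *
          (massM2 p ends a₁ a₂ a₃ b + deltaT p ends a₁ a₂ a₃ b) -
        (prob p (PDEvent ends a₁ a₂ a₃ ∩ connEvent ends a₁ o ∩ connEvent ends a₂ b) -
            deltaL p ends o a₁ a₂ a₃ b) *
          prob p (PDEvent ends a₁ a₂ a₃ ∩ (connEvent ends a₁ b)ᶜ)) +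
      (prob p (PDEvent ends a₁ a₂ a₃ ∩ connEvent ends a₁ o ∩ connEvent ends a₁ b) *
          (massM2 p ends a₁ a₂ a₃ b + deltaT p ends a₁ a₂ a₃ b) -
        (prob p (PDEvent ends a₁ a₂ a₃ ∩ connEvent ends a₁ o ∩ connEvent ends a₂ b) -
            deltaL p ends o a₁ a₂ a₃ b) *
          prob p (PDEvent ends a₁ a₂ a₃ ∩ connEvent ends a₁ b)) := by
  rw [prob_PD_split_b p ends a₁ a₂ a₃ b, prob_PDo_split_b p ends o a₁ a₂ a₃ b]
  ring

omit [Fintype V] [DecidableEq V] in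
/-- **(Yu1Δ) from its two b-split pieces**: `LA ∧ LB → Yu1Delta`. -/
theorem Yu1Delta_of_LA_LB (p : E → R) (ends : E → Sym2 V) {o a₁ a₂ a₃ b : V}
    (hA : LA p ends o a₁ a₂ a₃ b) (hB : LB p ends o a₁ a₂ a₃ b) : Yu1Delta p ends o a₁ a₂ a₃ b := by
  unfold LA at hA
  unfold LB at hB
  unfold Yu1Delta
  have e := Yu1Delta_slack_eq p ends o a₁ a₂ a₃ b
  linarith

/-- **(Yu1Δ) ⇐ (L_A)** under the labelling (since `LB` is a theorem there): the open content of
(Yu1Δ) is exactly (L_A). -/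
theorem Yu1Delta_of_LA (p : E → R) (hp : IsProbVec p) (ends : E → Sym2 V) {o a₁ a₂ a₃ b : V}
    (hord : prob p (connEvent ends a₁ b) ≤ prob p (connEvent ends a₂ b))
    (hA : LA p ends o a₁ a₂ a₃ b) : Yu1Delta p ends o a₁ a₂ a₃ b :=
  Yu1Delta_of_LA_LB p ends hA (LB_of_order p hp ends hord)

end YDeltaFacts

end Summit.Ventures.PercRepro2
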